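import Literature.Analysis.FluidPDE.NSLocalAnalyticityRadiusTube
import HarnessLib

/-!
# The local complex region: gluing holomorphic extensions over a cover by unit balls

Analysis/FluidPDE proofs file (theorems only), companion of `NSLocalAnalyticityRadius.lean`
(named fact `bradshawGrujicKukavica2015_local_analyticity_radius`, Bradshaw–Grujić–Kukavica,
J. Differential Equations 259 (2015), Thm. 2.3). Spatial analyticity with a uniform height is a
local property of the real slice: if above every unit ball `B(x₁, 1)`, `x₁ ∈ S`, the map `f`
has a holomorphic extension to the local region of height `h`, then it has one to the region
`{x + iy : x ∈ S, ‖y‖ < h}` above `S` — the extensions above overlapping balls agree on the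
overlap by the identity principle from the real ball
(`eqOn_localComplexTube_of_forall_complexify_eq`), so `z ↦ U_{x₁(z)}(z)` for any admissible
choice `x₁(z) ∈ S` within distance `1/2` of `Re z` is well defined and holomorphic
(`exists_differentiableOn_regionOver_of_forall_unit_ball`); above a ball `S = B(x_c, R)` the
region is `localComplexTube x_c R h`
(`exists_differentiableOn_localComplexTube_of_forall_unit_ball`).
This is the covering step reducing the fact to balls of unit (parabolic) size.

## References

* Z. Bradshaw, Z. Grujić, I. Kukavica, J. Differential Equations 259 (2015), proof of Thm. 2.1,
  p. 16 (local definition of the extension and its unique continuation to the region).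
  [BradshawGrujicKukavica2015]
-/

noncomputable section

open Set Function Filter TopologicalSpace Metric
open _root_.Topology
open Literature.Analysis.FunctionSpaces.EuclideanSpace (complexify complexify_apply norm_complexify
  complexify_injective continuous_complexify)

namespace Literature.Analysis.FluidPDE

/-- Local regions are monotone in the base ball: `B(x₀, ρ₀) ⊆ B(x₁, ρ₁)` implies
`Ω(x₀, ρ₀, h) ⊆ Ω(x₁, ρ₁, h)`. [folklore] -/
theorem localComplexTube_subset_of_ball_subset {x₀ x₁ : EuclideanSpace ℝ (Fin 3)} {ρ₀ ρ₁ h : ℝ}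
    (hb : ball x₀ ρ₀ ⊆ ball x₁ ρ₁) : localComplexTube x₀ ρ₀ h ⊆ localComplexTube x₁ ρ₁ h := by
  rintro z ⟨x, y, hx, hy, rfl⟩
  exact ⟨x, y, hb hx, hy, rfl⟩

/-- The real part `Re z ∈ ℝ³` of the point `complexify x + I • complexify y` is `x`. [folklore] -/
theorem toLp_re_complexify_add_I_smul (x y : EuclideanSpace ℝ (Fin 3)) :
    (WithLp.toLp 2 fun i => ((complexify x + Complex.I • complexify y) i).re :
      EuclideanSpace ℝ (Fin 3)) = x := by
  ext i
  simp

/-- The real part of a real point `complexify x` is `x`. [folklore] -/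
theorem toLp_re_complexify (x : EuclideanSpace ℝ (Fin 3)) :
    (WithLp.toLp 2 fun i => ((complexify x) i).re : EuclideanSpace ℝ (Fin 3)) = x := by
  ext i
  simp [complexify_apply]

/-- **Gluing holomorphic extensions over a cover by unit balls.** Let `S ⊆ ℝ³` and suppose that
for every `x₁ ∈ S` the map `f : ℝ³ → ℝ³` has a holomorphic extension from `B(x₁, 1)` to the
local region of height `h` above it. Then `f` has a holomorphic extension from `S` to the region
`{x + iy : x ∈ S, ‖y‖ < h}`: near a point above `x₀ ∈ S`, all the extensions `U_{x₁}` with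
`x₁ ∈ S`, `|x₁ - Re z| < 1/2` coincide with `U_{x₀}` on the region of radius `1/2` about `Re z`
(identity principle from the real ball), so the glued map is locally one of the `U_{x₁}`.
[cite: BradshawGrujicKukavica2015, proof of Thm. 2.1 (p. 16)] -/
theorem exists_differentiableOn_regionOver_of_forall_unit_ball {S : Set (EuclideanSpace ℝ (Fin 3))}
    {h : ℝ} {f : EuclideanSpace ℝ (Fin 3) → EuclideanSpace ℝ (Fin 3)}
    (H : ∀ x₁ ∈ S, ∃ U : EuclideanSpace ℂ (Fin 3) → EuclideanSpace ℂ (Fin 3),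
      DifferentiableOn ℂ U (localComplexTube x₁ 1 h) ∧
      ∀ x ∈ ball x₁ 1, U (complexify x) = complexify (f x)) :
    ∃ U : EuclideanSpace ℂ (Fin 3) → EuclideanSpace ℂ (Fin 3),
      DifferentiableOn ℂ U {z | ∃ x y : EuclideanSpace ℝ (Fin 3), x ∈ S ∧ ‖y‖ < h ∧
        z = complexify x + Complex.I • complexify y} ∧
      ∀ x ∈ S, U (complexify x) = complexify (f x) := by
  classical
  choose! U hUd hUf using H
  -- real part and an admissible centre for every point
  set re : EuclideanSpace ℂ (Fin 3) → EuclideanSpace ℝ (Fin 3) :=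
    fun z => WithLp.toLp 2 fun i => (z i).re with hre
  set ctr : EuclideanSpace ℂ (Fin 3) → EuclideanSpace ℝ (Fin 3) := fun z =>
    if hz : ∃ x₁ ∈ S, dist (re z) x₁ < 1 / 2 then hz.choose else 0 with hctr
  have hctr_spec : ∀ z, (∃ x₁ ∈ S, dist (re z) x₁ < 1 / 2) →
      ctr z ∈ S ∧ dist (re z) (ctr z) < 1 / 2 := by
    intro z hz
    simp only [hctr, dif_pos hz]
    exact hz.choose_spec
  -- two admissible extensions agree above `B(Re z, 1/2)`
  have hagree : ∀ (x₁ x₂ : EuclideanSpace ℝ (Fin 3)) (w : EuclideanSpace ℝ (Fin 3)),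
      x₁ ∈ S → x₂ ∈ S → dist w x₁ < 1 / 2 → dist w x₂ < 1 / 2 →
      EqOn (U x₁) (U x₂) (localComplexTube w (1 / 2) h) := by
    intro x₁ x₂ w hx₁ hx₂ hw₁ hw₂
    have hb₁ : ball w (1 / 2) ⊆ ball x₁ 1 := fun v hv => by
      rw [mem_ball] at hv ⊢; linarith [dist_triangle v w x₁]
    have hb₂ : ball w (1 / 2) ⊆ ball x₂ 1 := fun v hv => by
      rw [mem_ball] at hv ⊢; linarith [dist_triangle v w x₂]
    exact eqOn_localComplexTube_of_forall_complexify_eq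
      ((hUd x₁ hx₁).mono (localComplexTube_subset_of_ball_subset hb₁))
      ((hUd x₂ hx₂).mono (localComplexTube_subset_of_ball_subset hb₂))
      fun v hv => by rw [hUf x₁ hx₁ v (hb₁ hv), hUf x₂ hx₂ v (hb₂ hv)]
  refine ⟨fun z => U (ctr z) z, ?_, ?_⟩
  · rintro z₀ ⟨x₀, y₀, hx₀, hy₀, rfl⟩
    -- near `z₀` the glued map is `U x₀`
    set N := localComplexTube x₀ (1 / 2) h with hN
    have hNopen : IsOpen N := isOpen_localComplexTube x₀ (1 / 2) h
    have hz₀N : complexify x₀ + Complex.I • complexify y₀ ∈ N :=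
      ⟨x₀, y₀, by simp, hy₀, rfl⟩
    have hEq : EqOn (fun z => U (ctr z) z) (U x₀) N := by
      rintro z ⟨x, y, hx, hy, rfl⟩
      have hrez : re (complexify x + Complex.I • complexify y) = x :=
        toLp_re_complexify_add_I_smul x y
      have hex : ∃ x₁ ∈ S, dist (re (complexify x + Complex.I • complexify y)) x₁ < 1 / 2 :=
        ⟨x₀, hx₀, by rwa [hrez]⟩
      obtain ⟨hcS, hcd⟩ := hctr_spec _ hex
      rw [hrez] at hcd
      have hzmem : complexify x + Complex.I • complexify y ∈ localComplexTube x (1 / 2) h :=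
        ⟨x, y, by simp, hy, rfl⟩
      exact hagree _ _ x hcS hx₀ hcd hx hzmem
    have hdiff : DifferentiableAt ℂ (U x₀) (complexify x₀ + Complex.I • complexify y₀) :=
      (hUd x₀ hx₀).differentiableAt ((isOpen_localComplexTube x₀ 1 h).mem_nhds
        ⟨x₀, y₀, by simp, hy₀, rfl⟩)
    exact (hdiff.congr_of_eventuallyEq (Filter.eventuallyEq_of_mem (hNopen.mem_nhds hz₀N)
      hEq)).differentiableWithinAt
  · intro x hx
    have hrez : re (complexify x) = x := toLp_re_complexify x
    have hex : ∃ x₁ ∈ S, dist (re (complexify x)) x₁ < 1 / 2 := ⟨x, hx, by simp [hrez]⟩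
    obtain ⟨hcS, hcd⟩ := hctr_spec _ hex
    rw [hrez] at hcd
    show U (ctr (complexify x)) (complexify x) = complexify (f x)
    refine hUf _ hcS x ?_
    rw [mem_ball]
    linarith

/-- **Gluing over a ball.** If above every unit ball `B(x₁, 1)` with centre in `B(x_c, R)` the
map `f` has a holomorphic extension to the local region of height `h`, then it has one to
`localComplexTube x_c R h`, the region above `B(x_c, R)`.
[cite: BradshawGrujicKukavica2015, proof of Thm. 2.1 (p. 16)] -/
theorem exists_differentiableOn_localComplexTube_of_forall_unit_ball
    {xc : EuclideanSpace ℝ (Fin 3)} {R h : ℝ}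
    {f : EuclideanSpace ℝ (Fin 3) → EuclideanSpace ℝ (Fin 3)}
    (H : ∀ x₁ ∈ ball xc R, ∃ U : EuclideanSpace ℂ (Fin 3) → EuclideanSpace ℂ (Fin 3),
      DifferentiableOn ℂ U (localComplexTube x₁ 1 h) ∧
      ∀ x ∈ ball x₁ 1, U (complexify x) = complexify (f x)) :
    ∃ U : EuclideanSpace ℂ (Fin 3) → EuclideanSpace ℂ (Fin 3),
      DifferentiableOn ℂ U (localComplexTube xc R h) ∧
      ∀ x ∈ ball xc R, U (complexify x) = complexify (f x) := by
  obtain ⟨U, hUd, hUf⟩ := exists_differentiableOn_regionOver_of_forall_unit_ball H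
  refine ⟨U, hUd.mono ?_, hUf⟩
  rintro z ⟨x, y, hx, hy, rfl⟩
  exact ⟨x, y, hx, hy, rfl⟩

end Literature.Analysis.FluidPDE

end
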